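import Summits.Parity.BatemanHorn.Theorems.SoloInformedThinPolynomial
import Summits.Parity.BatemanHorn.Theorems.SoloInformedThinShortIntervalQ
import HarnessLib

/-!
# Thin sequences vs. Type-I/II information, XIV: polynomial values vs. short intervals

The headline corollaries of the series, stated for the supports that matter for
`BatemanHorn`: values of an integer sequence of polynomial growth `g k ≥ k^d`, `d ≥ 2`
(e.g. `k² + 1`).  Relative to Ford–Maynard's short-interval comparison sequences
`x/(2y) · 1_{(x−y, x]}` (`x^{1−η}/2 ≤ y ≤ x/2`) and their `q`-twisted versions
`(xq/2)/(yφ(q)) · 1_{x−y<n≤x, (n,q)=1}` (Lemma 4.6), and UNCONDITIONALLY (no hypothesis on the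
comparison side is left): no real weighting of such a support satisfies (II) in any window
`[θ, θ + ν]` with `θ + η < 1 − 1/d`, nor (I) at any level `γ > 1/d + η`.  For `k² + 1` and
`y ≍ x` (`η = 0`): no Type-II window below `1/2`, no Type-I level above `1/2` — whereas every
known (I)/(II)-based detection of primes needs `γ > 1/2` or a window reaching below `1/2`
(`FordMaynardLowLevel`, `FordMaynardMinimalTypeII` in `Literature.Barriers.Parity`).

* `eventually_not_typeII_polyGrowth_shortInterval`, `eventually_not_typeI_polyGrowth_shortInterval`,
  `eventually_not_typeII_sq_add_one_shortInterval`, `eventually_not_typeI_sq_add_one_shortInterval`;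
* `eventually_not_typeII_polyGrowth_shortInterval_coprime`,
  `eventually_not_typeI_polyGrowth_shortInterval_coprime` (general modulus `q`).

References: [cite: FordMaynard2024PrimeSieves, §2.4] [cite: FordMaynard2024PrimeSieves, §4.2
(Lemma 4.6)] [cite: FordMaynard2024PrimeSieves, §1 (I), (II), Theorems 1.1–1.2].
-/

noncomputable section

open Filter Finset Real

namespace Summit.Parity.BatemanHorn.Theorems

open Literature.Barriers.Parity.FordMaynard (TypeI TypeII eventually_mul_rpow_le_rpow)

/-- **Polynomial-growth supports vs. short intervals, Type II.**  Let `d ≥ 2`, `0 ≤ θ`, `0 ≤ η`,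
`θ + η < 1 − 1/d`, `ν > 0`, `B > 1`.  For all large `x`: if `g k ≥ k^d` and `a` vanishes on
`(x/2, x]` outside the image of `g`, then for every `x^{1−η}/2 ≤ y ≤ x/2` the sequence
`w = a − x/(2y) · 1_{(x−y, x]}` violates (II) in the window `[θ, θ + ν]` — unconditionally.
[cite: FordMaynard2024PrimeSieves, §2.4] [cite: FordMaynard2024PrimeSieves, §4.2 (Lemma 4.6)] -/
theorem eventually_not_typeII_polyGrowth_shortInterval {d : ℕ} (hd : 2 ≤ d) {θ ν B η : ℝ}
    (hθ : 0 ≤ θ) (hη : 0 ≤ η) (hθη : θ + η < 1 - 1 / d) (hν : 0 < ν) (hB : 1 < B) :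
    ∀ᶠ x : ℝ in atTop, ∀ (g : ℕ → ℕ), (∀ k, k ^ d ≤ g k) → ∀ (a : ℕ → ℝ) (y : ℝ),
      (∀ v : ℕ, x / 2 < (v : ℝ) → (v : ℝ) ≤ x → a v ≠ 0 → ∃ k, g k = v) →
      x ^ (1 - η) / 2 ≤ y → y ≤ x / 2 →
      ¬ TypeII (fun n : ℕ => a n -
        (Set.Ioc (x - y) x).indicator (fun _ : ℝ => x / (2 * y)) (n : ℝ)) x θ ν B := by
  have hd0 : d ≠ 0 := by omega
  have hdr : (2 : ℝ) ≤ d := by exact_mod_cast hd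
  have hdpos : (0 : ℝ) < 1 / d := by positivity
  set c : ℝ := (θ + η + (1 - 1 / d)) / 2 with hcdef
  have hθc : θ + η < c := by rw [hcdef]; linarith
  have hc1d : c < 1 - 1 / d := by rw [hcdef]; linarith
  have hc1 : c ≤ 1 := by linarith
  filter_upwards [eventually_not_typeII_shortInterval hθ hη hθc hc1 hν hB,
    eventually_mul_rpow_le_rpow 2 (by linarith : 1 / (d : ℝ) < 1 - c),
    eventually_ge_atTop (1 : ℝ)] with x hx e1 hx1 g hg a y ha hy1 hy2
  obtain ⟨A, hA, hcov⟩ := exists_cover_of_polyGrowth hd0 hg (by linarith) ha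
  have hx1d : 1 ≤ x ^ (1 / d : ℝ) := Real.one_le_rpow hx1 hdpos.le
  exact hx a A y (by linarith) hcov hy1 hy2

/-- **Polynomial-growth supports vs. short intervals, Type I.**  Let `d ≥ 2`, `0 ≤ η`,
`2η < 1 − 1/d`, `γ > 1/d + η`, `B > 1`.  For all large `x`: if `g k ≥ k^d` and `a` vanishes on
`(x/2, x]` outside the image of `g`, then for every `x^{1−η}/2 ≤ y ≤ x/2` the sequence
`w = a − x/(2y) · 1_{(x−y, x]}` violates (I) at level `x^γ`.
[cite: FordMaynard2024PrimeSieves, §2.4] [cite: FordMaynard2024PrimeSieves, §4.2 (Lemma 4.6)] -/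
theorem eventually_not_typeI_polyGrowth_shortInterval {d : ℕ} (hd : 2 ≤ d) {γ B η : ℝ}
    (hη : 0 ≤ η) (hη2 : 2 * η < 1 - 1 / d) (hγ : 1 / d + η < γ) (hB : 1 < B) :
    ∀ᶠ x : ℝ in atTop, ∀ (g : ℕ → ℕ), (∀ k, k ^ d ≤ g k) → ∀ (a : ℕ → ℝ) (y : ℝ),
      (∀ v : ℕ, x / 2 < (v : ℝ) → (v : ℝ) ≤ x → a v ≠ 0 → ∃ k, g k = v) →
      x ^ (1 - η) / 2 ≤ y → y ≤ x / 2 →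
      ¬ TypeI (fun n : ℕ => a n -
        (Set.Ioc (x - y) x).indicator (fun _ : ℝ => x / (2 * y)) (n : ℝ)) x γ B := by
  have hd0 : d ≠ 0 := by omega
  have hdr : (2 : ℝ) ≤ d := by exact_mod_cast hd
  have hdpos : (0 : ℝ) < 1 / d := by positivity
  have hm1 : 2 * η ≤ max (2 * η) (1 - γ + η) := le_max_left _ _
  have hm2 : 1 - γ + η ≤ max (2 * η) (1 - γ + η) := le_max_right _ _
  have hmax : max (2 * η) (1 - γ + η) < 1 - 1 / d := max_lt hη2 (by linarith)
  set c : ℝ := (max (2 * η) (1 - γ + η) + (1 - 1 / d)) / 2 with hcdef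
  have hη2c : 2 * η < c := by rw [hcdef]; linarith
  have hγc : 1 - c + η < γ := by rw [hcdef]; linarith
  have hc1d : c < 1 - 1 / d := by rw [hcdef]; linarith
  have hc1 : c ≤ 1 := by linarith
  filter_upwards [eventually_not_typeI_shortInterval hη hη2c hc1 hγc hB,
    eventually_mul_rpow_le_rpow 2 (by linarith : 1 / (d : ℝ) < 1 - c),
    eventually_ge_atTop (1 : ℝ)] with x hx e1 hx1 g hg a y ha hy1 hy2
  obtain ⟨A, hA, hcov⟩ := exists_cover_of_polyGrowth hd0 hg (by linarith) ha
  have hx1d : 1 ≤ x ^ (1 / d : ℝ) := Real.one_le_rpow hx1 hdpos.le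
  exact hx a A y (by linarith) hcov hy1 hy2

/-- **`n² + 1` vs. short intervals, Type II**: no weighting `a` of the numbers `k² + 1` in
`(x/2, x]` makes `a − x/(2y) · 1_{(x−y, x]}` satisfy (II) in a window `[θ, θ + ν]` with
`θ + η < 1/2`, for any `x^{1−η}/2 ≤ y ≤ x/2` (`x` large).
[cite: FordMaynard2024PrimeSieves, §2.4] -/
theorem eventually_not_typeII_sq_add_one_shortInterval {θ ν B η : ℝ} (hθ : 0 ≤ θ) (hη : 0 ≤ η)
    (hθη : θ + η < 1 / 2) (hν : 0 < ν) (hB : 1 < B) :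
    ∀ᶠ x : ℝ in atTop, ∀ (a : ℕ → ℝ) (y : ℝ),
      (∀ v : ℕ, x / 2 < (v : ℝ) → (v : ℝ) ≤ x → a v ≠ 0 → ∃ k, k ^ 2 + 1 = v) →
      x ^ (1 - η) / 2 ≤ y → y ≤ x / 2 →
      ¬ TypeII (fun n : ℕ => a n -
        (Set.Ioc (x - y) x).indicator (fun _ : ℝ => x / (2 * y)) (n : ℝ)) x θ ν B := by
  have h : θ + η < 1 - 1 / ((2 : ℕ) : ℝ) := by push_cast; linarith
  filter_upwards [eventually_not_typeII_polyGrowth_shortInterval (le_refl 2) hθ hη h hν hB]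
    with x hx a y ha
  exact hx (fun k => k ^ 2 + 1) (fun k => Nat.le_succ _) a y ha

/-- **`n² + 1` vs. short intervals, Type I**: … nor (I) at any level `γ > 1/2 + η` (`2η < 1/2`).
[cite: FordMaynard2024PrimeSieves, §2.4] -/
theorem eventually_not_typeI_sq_add_one_shortInterval {γ B η : ℝ} (hη : 0 ≤ η)
    (hη2 : 2 * η < 1 / 2) (hγ : 1 / 2 + η < γ) (hB : 1 < B) :
    ∀ᶠ x : ℝ in atTop, ∀ (a : ℕ → ℝ) (y : ℝ),
      (∀ v : ℕ, x / 2 < (v : ℝ) → (v : ℝ) ≤ x → a v ≠ 0 → ∃ k, k ^ 2 + 1 = v) →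
      x ^ (1 - η) / 2 ≤ y → y ≤ x / 2 →
      ¬ TypeI (fun n : ℕ => a n -
        (Set.Ioc (x - y) x).indicator (fun _ : ℝ => x / (2 * y)) (n : ℝ)) x γ B := by
  have h2 : 2 * η < 1 - 1 / ((2 : ℕ) : ℝ) := by push_cast; linarith
  have hγ' : 1 / ((2 : ℕ) : ℝ) + η < γ := by push_cast; linarith
  filter_upwards [eventually_not_typeI_polyGrowth_shortInterval (le_refl 2) hη h2 hγ' hB]
    with x hx a y ha
  exact hx (fun k => k ^ 2 + 1) (fun k => Nat.le_succ _) a y ha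

/-- **Polynomial-growth supports vs. Ford–Maynard's `q`-twisted short intervals, Type II.**
As `eventually_not_typeII_polyGrowth_shortInterval`, for the comparison sequence
`b_n = (xq/2)/(yφ(q)) · 1_{x−y<n≤x, (n,q)=1}` of Lemma 4.6: every `q ≥ 1`, `y ≤ x/2` with
`2 x^κ q ≤ y` (`κ > θ`) and `x^{1−η} q ≤ 2 y φ(q)`.
[cite: FordMaynard2024PrimeSieves, §4.2 (Lemma 4.6)] -/
theorem eventually_not_typeII_polyGrowth_shortInterval_coprime {d : ℕ} (hd : 2 ≤ d)
    {θ ν B η κ : ℝ} (hθ : 0 ≤ θ) (hη : 0 ≤ η) (hθη : θ + η < 1 - 1 / d) (hν : 0 < ν)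
    (hB : 1 < B) (hκ : θ < κ) :
    ∀ᶠ x : ℝ in atTop, ∀ (g : ℕ → ℕ), (∀ k, k ^ d ≤ g k) → ∀ (a : ℕ → ℝ) (y : ℝ) (q : ℕ),
      (∀ v : ℕ, x / 2 < (v : ℝ) → (v : ℝ) ≤ x → a v ≠ 0 → ∃ k, g k = v) → 0 < q →
      x ^ (1 - η) * q ≤ 2 * y * (q.totient : ℝ) → 2 * x ^ κ * q ≤ y → y ≤ x / 2 →
      ¬ TypeII (fun n : ℕ => a n - (if x - y < (n : ℝ) ∧ (n : ℝ) ≤ x ∧ Nat.Coprime n q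
        then x * q / (2 * y * (q.totient : ℝ)) else 0)) x θ ν B := by
  have hd0 : d ≠ 0 := by omega
  have hdr : (2 : ℝ) ≤ d := by exact_mod_cast hd
  have hdpos : (0 : ℝ) < 1 / d := by positivity
  set c : ℝ := (θ + η + (1 - 1 / d)) / 2 with hcdef
  have hθc : θ + η < c := by rw [hcdef]; linarith
  have hc1d : c < 1 - 1 / d := by rw [hcdef]; linarith
  have hc1 : c ≤ 1 := by linarith
  filter_upwards [eventually_not_typeII_shortInterval_coprime hθ hη hθc hc1 hν hB hκ,
    eventually_mul_rpow_le_rpow 2 (by linarith : 1 / (d : ℝ) < 1 - c),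
    eventually_ge_atTop (1 : ℝ)] with x hx e1 hx1 g hg a y q ha hq hh hqy hyx
  obtain ⟨A, hA, hcov⟩ := exists_cover_of_polyGrowth hd0 hg (by linarith) ha
  have hx1d : 1 ≤ x ^ (1 / d : ℝ) := Real.one_le_rpow hx1 hdpos.le
  exact hx a A y q (by linarith) hcov hq hh hqy hyx

/-- **Polynomial-growth supports vs. Ford–Maynard's `q`-twisted short intervals, Type I.**
As `eventually_not_typeI_polyGrowth_shortInterval`, for `b_n = (xq/2)/(yφ(q)) · 1_{x−y<n≤x,
(n,q)=1}`: every `q ≥ 1`, `y ≤ x/2` with `2 x^κ q ≤ y` (`κ > 1/d + η`), `x^{1−η} q ≤ 2 y φ(q)`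
(`η < 1 − 1/d`).
[cite: FordMaynard2024PrimeSieves, §4.2 (Lemma 4.6)] -/
theorem eventually_not_typeI_polyGrowth_shortInterval_coprime {d : ℕ} (hd : 2 ≤ d)
    {γ B η κ : ℝ} (hη : 0 ≤ η) (hη1 : η < 1 - 1 / d) (hγ : 1 / d + η < γ) (hB : 1 < B)
    (hκ : 1 / d + η < κ) :
    ∀ᶠ x : ℝ in atTop, ∀ (g : ℕ → ℕ), (∀ k, k ^ d ≤ g k) → ∀ (a : ℕ → ℝ) (y : ℝ) (q : ℕ),
      (∀ v : ℕ, x / 2 < (v : ℝ) → (v : ℝ) ≤ x → a v ≠ 0 → ∃ k, g k = v) → 0 < q →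
      x ^ (1 - η) * q ≤ 2 * y * (q.totient : ℝ) → 2 * x ^ κ * q ≤ y → y ≤ x / 2 →
      ¬ TypeI (fun n : ℕ => a n - (if x - y < (n : ℝ) ∧ (n : ℝ) ≤ x ∧ Nat.Coprime n q
        then x * q / (2 * y * (q.totient : ℝ)) else 0)) x γ B := by
  have hd0 : d ≠ 0 := by omega
  have hdr : (2 : ℝ) ≤ d := by exact_mod_cast hd
  have hdpos : (0 : ℝ) < 1 / d := by positivity
  have hdinv : (1 : ℝ) / d ≤ 1 / 2 := by
    rw [div_le_div_iff₀ (by positivity) (by norm_num)]; linarith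
  set M : ℝ := max (max (1 - γ + η) (1 - κ + η)) η with hMdef
  have hm1 : 1 - γ + η ≤ M := le_trans (le_max_left _ _) (le_max_left _ _)
  have hm2 : 1 - κ + η ≤ M := le_trans (le_max_right _ _) (le_max_left _ _)
  have hm3 : η ≤ M := le_max_right _ _
  have hmax : M < 1 - 1 / d := max_lt (max_lt (by linarith) (by linarith)) hη1
  set c : ℝ := (M + (1 - 1 / d)) / 2 with hcdef
  have hηc : η < c := by rw [hcdef]; linarith
  have hγc : 1 - c + η < γ := by rw [hcdef]; linarith
  have hκc : 1 - c + η < κ := by rw [hcdef]; linarith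
  have hc1d : c < 1 - 1 / d := by rw [hcdef]; linarith
  have hc1 : c ≤ 1 := by linarith
  filter_upwards [eventually_not_typeI_shortInterval_coprime hη hηc hc1 hγc hB hκc,
    eventually_mul_rpow_le_rpow 2 (by linarith : 1 / (d : ℝ) < 1 - c),
    eventually_ge_atTop (1 : ℝ)] with x hx e1 hx1 g hg a y q ha hq hh hqy hyx
  obtain ⟨A, hA, hcov⟩ := exists_cover_of_polyGrowth hd0 hg (by linarith) ha
  have hx1d : 1 ≤ x ^ (1 / d : ℝ) := Real.one_le_rpow hx1 hdpos.le
  exact hx a A y q (by linarith) hcov hq hh hqy hyx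

end Summit.Parity.BatemanHorn.Theorems

end
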